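import Summits.CriticalPhenomena.PercolationContinuityZ3.Theorems.PercNearOneGluingNoHeavyLowerTailSahiTangentPattern

/-!
# `NoHeavyLowerTail` (crux stmt-CriticalPhenomena-4575), Sahi programme: **`TangentPatternPos 4` IS FALSE** — the order-3 tangent /
# contraction inequality ('Conjecture T₃') FAILS for a product measure on `{0,1}⁴ × coin` (explicit, exact; certificate by `native_decide`)

Support file (Sahi cell, seat `prim-sahi-p1`, generation 47; `--supports stmt-CriticalPhenomena-4575`); part 7 of the tangent files.  COMPUTATIONAL:
the sign of the integer `cexSum` (a sum of `4096` explicit integer terms) is evaluated by `native_decide` (`cexSum_neg`); everything else is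
kernel-checked with standard axioms.  Definitions: the explicit data `cexW`, `cT0`, `cT1`, `cT2`, `cB0`, `cB1`, `cexT`, `cexB`, `cexSum` only.

THE MATHEMATICS.  `…SahiTangentPattern` reduces the tangent inequality `T₃ ≥ 0` on `d`-dimensional grids × coin (product weights) to the finite
predicate `TangentPatternPos d`, true for `d ≤ 2` (enumeration outside Lean).  Here: **it is false for `d = 4`.**  The seat's adversarial search
(kit j305714, memo FROM-prim-sahi-p1-gen47-TANGENT-ALL-ORDERS §1 (1.7), evidence CEX-tangent-T3-cube4-gen47.md on stmt-4575) found, and exact arithmetic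
confirmed, product measures on `{0,1}⁴` and pairs of up-sets `B_i ⊆ T_i` with `T₃ = E₃(1) − E₃′(1) < 0`; the first one is formalised here:
`q = (341/625, 599/5000, 643/1000, 507/1250)` (integer chain weights `cexW a = (1−q_a, q_a)·denominator`),
`T₀ = {x₃ ∧ (x₀ ∨ x₂)} ⊇ B₀ = {x₀ ∧ x₃}`, `T₁ = {x₁ ∧ (x₀ ∨ x₂ ∨ x₃)} ⊇ B₁ = {x₁ ∧ x₂}`, `T₂ = B₂ = {(x₁∧x₂) ∨ (x₀∧(x₂∨x₃))}`
(0-based coordinates), with `tangentForm = cexSum = −9 226 454 889 388 483 349 713 328 400 000 000 < 0`, i.e. `T₃ ≈ −1.55·10⁻⁴` after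
normalisation (`E₃(tops) ≈ 0.0247 > 0`, `E₃(bottoms) = 0` exactly — `B₀, B₁` are independent and `B₀ ∪ B₁ ⊆ T₂`).  Since
`tangentForm_gridProd_nonneg_of : TangentPatternPos 4 → 0 ≤ tangentForm …` for every nonnegative product weight on `[2]^4`, this REFUTES
`TangentPatternPos 4` (`not_tangentPatternPos_four`), hence the order-3 'Conjecture T' of the p2 memo FROM-prim-sahi-p2-gen32-TANGENT ("for every FKG
weight on `L × Bool` and increasing events, `E₃ ≥ P(ε=1)·E₃(·|ε=1)`") for `L = {0,1}⁴` with a product weight; the contraction form fails as well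
(`E(p) − p·E(1) < 0` at `p = 1/2, 9/10, 99/100`, memo).  CONTEXT: the inequality HOLDS on every chain (all orders, `…SahiTangentAllOrders`), for every FKG
weight on `Bool × chain` (`…SahiTangentFKGChain`), for `{0,1}^m × coin`, `m ≤ 3` (p2, certified) and on every 2-D grid × coin (TPP(2), census); and
`PatternPos 4` (Kahn's `C₃` coefficientwise on 4-grids) is certified TRUE — the tangent strengthening breaks exactly at `d = 4`.  The percolation
inequality R23 is NOT refuted (these events are not cluster events), but it is not a consequence of 'increasing events + product measure'. [this work]
-/

namespace Summit.CriticalPhenomena.PercolationContinuityZ3.Theorems.SahiTangent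

open Finset Literature.Probability.LatticeModels Literature.Combinatorics.Sahi2008
open SahiGrid3 (ind)
open SahiGridPattern (Xd Pd)
open scoped BigOperators

noncomputable section

/-- Integer chain weights of the counterexample: `g_a(0), g_a(1)` proportional to `(1 − q_a, q_a)` with
`q = (341/625, 599/5000, 643/1000, 507/1250)`. [this work] -/
def cexW : Fin 4 → Fin 2 → ℕ := ![![284, 341], ![4401, 599], ![357, 643], ![743, 507]]

/-- Top of slot 0: `{x₃ ∧ (x₀ ∨ x₂)}` (0-based coordinates of `{0,1}⁴`). [this work] -/
def cT0 : Finset (Xd 4 1) := univ.filter fun x => x 3 = 1 ∧ (x 0 = 1 ∨ x 2 = 1)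
/-- Top of slot 1: `{x₁ ∧ (x₀ ∨ x₂ ∨ x₃)}`. [this work] -/
def cT1 : Finset (Xd 4 1) := univ.filter fun x => x 1 = 1 ∧ (x 0 = 1 ∨ x 2 = 1 ∨ x 3 = 1)
/-- Top (= bottom) of slot 2: `{(x₁ ∧ x₂) ∨ (x₀ ∧ (x₂ ∨ x₃))}`. [this work] -/
def cT2 : Finset (Xd 4 1) := univ.filter fun x => (x 1 = 1 ∧ x 2 = 1) ∨ (x 0 = 1 ∧ (x 2 = 1 ∨ x 3 = 1))
/-- Bottom of slot 0: `{x₀ ∧ x₃}`. [this work] -/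
def cB0 : Finset (Xd 4 1) := univ.filter fun x => x 0 = 1 ∧ x 3 = 1
/-- Bottom of slot 1: `{x₁ ∧ x₂}`. [this work] -/
def cB1 : Finset (Xd 4 1) := univ.filter fun x => x 1 = 1 ∧ x 2 = 1

/-- The tops of the counterexample. [this work] -/
def cexT : Fin 3 → Finset (Xd 4 1) := ![cT0, cT1, cT2]

/-- The bottoms of the counterexample (slot 2 has no defect). [this work] -/
def cexB : Fin 3 → Finset (Xd 4 1) := ![cB0, cB1, cT2]

/-- The integer tangent form of the counterexample (a computable integer). [this work] -/
def cexSum : ℤ :=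
  ∑ ω : Fin 3 → Xd 4 1, (∏ c, ∏ a, (cexW a (ω c a) : ℤ)) * tker cexT cexB (ω 0) (ω 1) (ω 2)

/-- The integer tangent form is negative (native evaluation of the `4096`-term sum; value
`= −9 226 454 889 388 483 349 713 328 400 000 000`, i.e. `T₃ ≈ −1.55·10⁻⁴` after normalisation; re-computed independently in Python, code/gen47/cexsum_check.py). [this work] [computational: native_decide] -/
theorem cexSum_neg : cexSum < 0 := by native_decide

/-- The real tangent form of the integer product weight is the cast of `cexSum`. [this work] -/
theorem tangentForm_cex : tangentForm (fun ω : Xd 4 1 => ∏ a, (cexW a (ω a) : ℝ)) cexT cexB = (cexSum : ℝ) := by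
  unfold tangentForm cexSum
  push_cast
  rfl

/-- Up-sets of `{0,1}⁴` cut out by monotone Boolean formulas (bookkeeping). [this work] -/
theorem isUpperSet_filter_of_mono {P : Xd 4 1 → Prop} [DecidablePred P]
    (hP : ∀ a b : Xd 4 1, (∀ j, a j = 1 → b j = 1) → P a → P b) :
    IsUpperSet ((univ.filter P : Finset (Xd 4 1)) : Set (Xd 4 1)) := by
  intro a b hab ha
  rw [Finset.coe_filter] at ha ⊢
  refine ⟨Finset.mem_univ _, hP a b (fun j hj => ?_) ha.2⟩
  have h1 : a j ≤ b j := hab j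
  have h2 := (b j).isLt
  rw [Fin.le_def, hj] at h1
  exact Fin.ext (by simp at h1 ⊢; omega)

/-- `cT0` is an up-set. [this work] -/
theorem cT0_up : IsUpperSet ((cT0 : Finset (Xd 4 1)) : Set (Xd 4 1)) :=
  isUpperSet_filter_of_mono fun a b h ha => by
    rcases ha with ⟨h3, h0 | h2⟩
    · exact ⟨h 3 h3, Or.inl (h 0 h0)⟩
    · exact ⟨h 3 h3, Or.inr (h 2 h2)⟩

/-- `cT1` is an up-set. [this work] -/
theorem cT1_up : IsUpperSet ((cT1 : Finset (Xd 4 1)) : Set (Xd 4 1)) :=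
  isUpperSet_filter_of_mono fun a b h ha => by
    rcases ha with ⟨h1, h0 | h2 | h3⟩
    · exact ⟨h 1 h1, Or.inl (h 0 h0)⟩
    · exact ⟨h 1 h1, Or.inr (Or.inl (h 2 h2))⟩
    · exact ⟨h 1 h1, Or.inr (Or.inr (h 3 h3))⟩

/-- `cT2` is an up-set. [this work] -/
theorem cT2_up : IsUpperSet ((cT2 : Finset (Xd 4 1)) : Set (Xd 4 1)) :=
  isUpperSet_filter_of_mono fun a b h ha => by
    rcases ha with ⟨h1, h2⟩ | ⟨h0, h2 | h3⟩
    · exact Or.inl ⟨h 1 h1, h 2 h2⟩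
    · exact Or.inr ⟨h 0 h0, Or.inl (h 2 h2)⟩
    · exact Or.inr ⟨h 0 h0, Or.inr (h 3 h3)⟩

/-- `cB0` is an up-set. [this work] -/
theorem cB0_up : IsUpperSet ((cB0 : Finset (Xd 4 1)) : Set (Xd 4 1)) :=
  isUpperSet_filter_of_mono fun _ _ h ha => ⟨h 0 ha.1, h 3 ha.2⟩

/-- `cB1` is an up-set. [this work] -/
theorem cB1_up : IsUpperSet ((cB1 : Finset (Xd 4 1)) : Set (Xd 4 1)) :=
  isUpperSet_filter_of_mono fun _ _ h ha => ⟨h 1 ha.1, h 2 ha.2⟩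

/-- The tops are up-sets. [this work] -/
theorem isUpperSet_cexT : ∀ i, IsUpperSet ((cexT i : Finset (Xd 4 1)) : Set (Xd 4 1)) := by
  intro i
  fin_cases i
  · exact cT0_up
  · exact cT1_up
  · exact cT2_up

/-- The bottoms are up-sets. [this work] -/
theorem isUpperSet_cexB : ∀ i, IsUpperSet ((cexB i : Finset (Xd 4 1)) : Set (Xd 4 1)) := by
  intro i
  fin_cases i
  · exact cB0_up
  · exact cB1_up
  · exact cT2_up

/-- Bottoms below tops. [this work] -/
theorem cexB_subset_cexT : ∀ i, cexB i ⊆ cexT i := by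
  intro i
  fin_cases i
  · show cB0 ⊆ cT0
    intro x hx
    rw [cB0, Finset.mem_filter] at hx
    rw [cT0, Finset.mem_filter]
    exact ⟨hx.1, hx.2.2, Or.inl hx.2.1⟩
  · show cB1 ⊆ cT1
    intro x hx
    rw [cB1, Finset.mem_filter] at hx
    rw [cT1, Finset.mem_filter]
    exact ⟨hx.1, hx.2.1, Or.inr (Or.inl hx.2.2)⟩
  · exact subset_of_eq rfl

/-- **`TangentPatternPos 4` IS FALSE.**  The tangent pattern inequality fails in dimension `4`: by `tangentForm_gridProd_nonneg_of` it would make the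
tangent form of every nonnegative product weight on `{0,1}⁴ = [2]^4` nonnegative, but for the integer weights `cexW` (∝ the product measure with
`q = (341/625, 599/5000, 643/1000, 507/1250)`) and the pairs `cexB ⊆ cexT` it equals `cexSum < 0`.  Equivalently: the order-3 TANGENT / CONTRACTION
inequality `E₃^{B_p⊗μ}(F) ≥ p·E₃^{μ}(F|top)` ('Conjecture T₃' of the p2 memo FROM-prim-sahi-p2-gen32-TANGENT) FAILS for this product measure on
`{0,1}⁴ × coin` (exact value `T₃ ≈ −1.55·10⁻⁴`; `E₃(tops) > 0`, `E₃(bottoms) = 0`).  It HOLDS on chains (every order), on `Bool × chain` for FKG weights,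
and (census-grade) on all 2-D grids × coin; `PatternPos 4` itself is certified true — the tangent strengthening of Kahn's conjecture breaks at `d = 4`.
[this work] [computational: depends on `cexSum_neg` (native_decide)] -/
theorem not_tangentPatternPos_four : ¬ TangentPatternPos 4 := by
  intro h
  have h0 := tangentForm_gridProd_nonneg_of h (fun a u => (cexW a u : ℝ)) (fun a u => by positivity)
    isUpperSet_cexT isUpperSet_cexB cexB_subset_cexT
  rw [tangentForm_cex] at h0
  have h1 : (cexSum : ℝ) < 0 := by exact_mod_cast cexSum_neg
  exact absurd h0 (not_le.2 h1)

end

end Summit.CriticalPhenomena.PercolationContinuityZ3.Theorems.SahiTangent
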